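import Summits.AtomisticToContinuum.Crystallization.Theorems.SpectralChargeLedgerShellsToLayersGoodOfLimit
import Summits.AtomisticToContinuum.Crystallization.Theorems.GappedShellCensusCleanLimitsHaveWindowsLayeredAtlas

/-!
# `SpectralChargeLedger.ShellsToLayers` (stmt-AtomisticToContinuum-17254), line `blowup-slot-layering` —
# the slot dictionary: template shells on the box ARE the slot models `range (slotH/slotC a₀ h₀ h₀)`

Helper file for the crux `ShellsToLayers` of route `SpectralChargeLedger` (supports
stmt-AtomisticToContinuum-17254; proves the registered dictionary stub `stub_templateShells` of the line
`Cruxes/ShellsToLayers/Lines/blowup_slot_layering.lean`, used by stub S3 `stub_exactSlotLayering`).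

On the parameter box (`47/50 ≤ a₀ ≤ 1`, `|h₀ − a₀√(2/3)| ≤ a₀/100`) the punctured open `13/10·a₀`-shell of
the origin in `hcpStacking a₀ h₀` (resp. `fccStacking a₀ h₀`) is EXACTLY the twelve-point slot model
`Set.range (CleanHull.slotH a₀ h₀ h₀)` (resp. `slotC`): six in-plane neighbours of norm `a₀`, two triangles
of norm `√(a₀²/3 + h₀²) ∈ [0.9918, 1.0083]·a₀` in the layers `±1` (eclipsed for the alternating word — both
layers carry the label `1` —, staggered for the constant word — labels `±1`); the next sites have norm
`≥ 1.408·a₀` in-plane and `2h₀ ≥ 1.61·a₀` two layers away.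

* `barlowPos_eq_laPt` — the sites of the three central layers through the integer atlas `CleanHull.laPt`;
* `abs_mul_le_norm_barlowPos` — `|k h| ≤ ‖barlowPos a h s k i j‖`;
* `laCodeH_barlow`, `laCodeC_barlow` — the twelve slot codes are site codes of the three central layers
  (`fin_cases` + `decide`); `layer_of_norm_lt`, `triangle_of_form_le_zero(')` —
  the census of short sites (layer `k ∈ {-1,0,1}`; in-plane quadratic forms);
* `stub_templateShells` — the registered stub (both letters);
* `laSlot_norm_band` — every slot of either model has norm in `[0.98a₀, 1.02a₀]` (`la_norm_code`).

All `[folklore]` (Conway–Sloane Ch. 1 §1.3; Hales DSP 2012 §1.3: coordination shells of the close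
packings). No definitions. Dictionary lemmas from ideator 2's `SketchIdeator2.lean` (crux-ideate r1).
-/

noncomputable section

namespace Summit.AtomisticToContinuum.Crystallization.Theorems.ShellsToLayers

open Literature.MathematicalPhysics.StatisticalMechanics
open Summit.AtomisticToContinuum.Crystallization.Theorems.CleanHull

/-- `barlowPos` through the integer atlas, for the three central layers `k ∈ {-1, 0, 1}`. [folklore] -/
theorem barlowPos_eq_laPt (a h : ℝ) (s : ℤ → ℤ) {k : ℤ} (hk : k = -1 ∨ k = 0 ∨ k = 1) (i j : ℤ) :
    barlowPos a h s k i j = laPt a h h (3 * i + haggLabel s k, 3 * j + haggLabel s k, k) := by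
  ext l
  fin_cases l
  · simp [laPt, triangularVec₁, triangularVec₂, layerNormal]
    ring
  · simp [laPt, triangularVec₁, triangularVec₂, layerNormal]
    ring
  · rcases hk with rfl | rfl | rfl <;> simp [laPt, laHt, triangularVec₁, triangularVec₂, layerNormal]

/-- The vertical coordinate bounds the norm from below: `|k h| ≤ ‖barlowPos a h s k i j‖`. [folklore] -/
theorem abs_mul_le_norm_barlowPos (a h : ℝ) (s : ℤ → ℤ) (k i j : ℤ) :
    |(k : ℝ) * h| ≤ ‖barlowPos a h s k i j‖ := by
  have := PiLp.dist_apply_le (barlowPos a h s k i j) (0 : EuclideanSpace ℝ (Fin 3)) 2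
  simpa [Real.dist_eq] using this

/-- The twelve hexagonal slot codes are site codes of the alternating stacking: layer `k ∈ {-1, 0, 1}`,
label `0` in layer `0` and `1` in layers `±1`. [folklore] -/
theorem laCodeH_barlow (m : Fin 12) : ∃ k i j : ℤ, (k = -1 ∨ k = 0 ∨ k = 1) ∧
    laCodeH m = (3 * i + (if k = 0 then 0 else 1), 3 * j + (if k = 0 then 0 else 1), k) := by
  fin_cases m
  · exact ⟨0, 1, 0, by decide⟩
  · exact ⟨0, -1, 0, by decide⟩
  · exact ⟨0, 0, 1, by decide⟩
  · exact ⟨0, 0, -1, by decide⟩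
  · exact ⟨0, 1, -1, by decide⟩
  · exact ⟨0, -1, 1, by decide⟩
  · exact ⟨1, 0, 0, by decide⟩
  · exact ⟨1, -1, 0, by decide⟩
  · exact ⟨1, 0, -1, by decide⟩
  · exact ⟨-1, 0, 0, by decide⟩
  · exact ⟨-1, -1, 0, by decide⟩
  · exact ⟨-1, 0, -1, by decide⟩

/-- The twelve cubic slot codes are site codes of the constant stacking: layer `k ∈ {-1, 0, 1}`, label `k`.
[folklore] -/
theorem laCodeC_barlow (m : Fin 12) : ∃ k i j : ℤ, (k = -1 ∨ k = 0 ∨ k = 1) ∧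
    laCodeC m = (3 * i + k, 3 * j + k, k) := by
  fin_cases m
  · exact ⟨0, 1, 0, by decide⟩
  · exact ⟨0, -1, 0, by decide⟩
  · exact ⟨0, 0, 1, by decide⟩
  · exact ⟨0, 0, -1, by decide⟩
  · exact ⟨0, 1, -1, by decide⟩
  · exact ⟨0, -1, 1, by decide⟩
  · exact ⟨1, 0, 0, by decide⟩
  · exact ⟨1, -1, 0, by decide⟩
  · exact ⟨1, 0, -1, by decide⟩
  · exact ⟨-1, 0, 0, by decide⟩
  · exact ⟨-1, 1, 0, by decide⟩
  · exact ⟨-1, 0, 1, by decide⟩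

/-- The layer index of a site of norm `< 13/10·a₀` is `-1`, `0` or `1` (on the box `2h₀ > 1.3a₀`). [folklore] -/
theorem layer_of_norm_lt {a₀ h₀ : ℝ} (hlo : 806 / 1000 * a₀ ≤ h₀) (hh0 : 0 < h₀) (s : ℤ → ℤ) {k i j : ℤ}
    (hnorm : ‖barlowPos a₀ h₀ s k i j‖ < 13 / 10 * a₀) : k = -1 ∨ k = 0 ∨ k = 1 := by
  have hz := abs_mul_le_norm_barlowPos a₀ h₀ s k i j
  have h1 : |(k : ℝ)| * h₀ < 13 / 10 * a₀ := by
    rw [abs_mul, abs_of_pos hh0] at hz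
    exact hz.trans_lt hnorm
  have h2 : |(k : ℝ)| < 2 := by
    nlinarith [mul_nonneg (abs_nonneg (k : ℝ)) (sub_nonneg.2 hlo), abs_nonneg (k : ℝ)]
  have h3 : |k| < 2 := by exact_mod_cast h2
  rcases abs_lt.1 h3 with ⟨h4, h5⟩
  omega

/-- In-plane census, label `1`: an integer point with `i² + ij + j² + i + j ≤ 0` is one of the three triangle
points `(0,0), (-1,0), (0,-1)`. [folklore] -/
theorem triangle_of_form_le_zero {i j : ℤ} (hQ : i ^ 2 + i * j + j ^ 2 + i + j ≤ 0) :
    (i, j) = (0, 0) ∨ (i, j) = (-1, 0) ∨ (i, j) = (0, -1) := by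
  have hj1 : 3 * j ^ 2 + 2 * j - 1 ≤ 0 := by nlinarith [sq_nonneg (2 * i + j + 1)]
  have hi1 : 3 * i ^ 2 + 2 * i - 1 ≤ 0 := by nlinarith [sq_nonneg (2 * j + i + 1)]
  have hj2 : -1 ≤ j := by nlinarith
  have hj3 : j ≤ 0 := by nlinarith
  have hi2 : -1 ≤ i := by nlinarith
  have hi3 : i ≤ 0 := by nlinarith
  interval_cases i <;> interval_cases j <;> simp_all

/-- In-plane census, label `-1`: an integer point with `i² + ij + j² - i - j ≤ 0` is one of the three triangle
points `(0,0), (1,0), (0,1)`. [folklore] -/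
theorem triangle_of_form_le_zero' {i j : ℤ} (hQ : i ^ 2 + i * j + j ^ 2 - i - j ≤ 0) :
    (i, j) = (0, 0) ∨ (i, j) = (1, 0) ∨ (i, j) = (0, 1) := by
  have hj1 : 3 * j ^ 2 - 2 * j - 1 ≤ 0 := by nlinarith [sq_nonneg (2 * i + j - 1)]
  have hi1 : 3 * i ^ 2 - 2 * i - 1 ≤ 0 := by nlinarith [sq_nonneg (2 * j + i - 1)]
  have hj2 : 0 ≤ j := by nlinarith
  have hj3 : j ≤ 1 := by nlinarith
  have hi2 : 0 ≤ i := by nlinarith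
  have hi3 : i ≤ 1 := by nlinarith
  interval_cases i <;> interval_cases j <;> simp_all

/-- **The registered dictionary stub of the line `blowup-slot-layering` (signature verbatim).** On the box the
punctured open `13/10·a₀`-shells of the origin in `hcpStacking a₀ h₀` and in `fccStacking a₀ h₀` are the slot
models `Set.range (slotH a₀ h₀ h₀)` and `Set.range (slotC a₀ h₀ h₀)`. [folklore] -/
theorem stub_templateShells : ∀ (a₀ h₀ : ℝ), 47 / 50 ≤ a₀ → |h₀ - a₀ * Real.sqrt (2 / 3)| ≤ a₀ / 100 → {q : EuclideanSpace ℝ (Fin 3) | q ∈ Literature.MathematicalPhysics.StatisticalMechanics.hcpStacking a₀ h₀ ∧ q ≠ 0 ∧ ‖q‖ < 13 / 10 * a₀} = Set.range (Summit.AtomisticToContinuum.Crystallization.Theorems.CleanHull.slotH a₀ h₀ h₀) ∧ {q : EuclideanSpace ℝ (Fin 3) | q ∈ Literature.MathematicalPhysics.StatisticalMechanics.fccStacking a₀ h₀ ∧ q ≠ 0 ∧ ‖q‖ < 13 / 10 * a₀} = Set.range (Summit.AtomisticToContinuum.Crystallization.Theorems.CleanHull.slotC a₀ h₀ h₀) :=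 by
  intro a₀ h₀ ha hh
  obtain ⟨ha0, hlo, hhi⟩ := inBox_bounds ha hh
  have hh0 : 0 < h₀ := by linarith
  -- norms of the slots: non-zero and `< 13/10·a₀`, either model
  have hslot : ∀ (t : Bool) (m : Fin 12), laSlot t a₀ h₀ h₀ m ≠ 0 ∧ ‖laSlot t a₀ h₀ h₀ m‖ < 13 / 10 * a₀ := by
    intro t m
    have hn := la_norm_code (kp := h₀) (km := h₀) ha0 t m
    rw [← laSlot_eq_laPt] at hn
    constructor
    · intro h0
      rw [h0, norm_zero] at hn
      rcases hn with ⟨-, hn⟩ | ⟨-, hn⟩ | ⟨-, hn⟩ <;> nlinarith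
    · have hlt : ‖laSlot t a₀ h₀ h₀ m‖ ^ 2 < (13 / 10 * a₀) ^ 2 := by
        rcases hn with ⟨-, hn⟩ | ⟨-, hn⟩ | ⟨-, hn⟩
        · rw [hn]; nlinarith
        · rw [hn]; nlinarith
        · rw [hn]; nlinarith
      exact lt_of_pow_lt_pow_left₀ 2 (by positivity) hlt
  -- the in-plane census of a short site, by label `L ∈ {0, 1, -1}` of its layer
  have hcensus : ∀ (s : ℤ → ℤ) (k i j : ℤ), (k = -1 ∨ k = 0 ∨ k = 1) →
      barlowPos a₀ h₀ s k i j ≠ 0 → ‖barlowPos a₀ h₀ s k i j‖ < 13 / 10 * a₀ →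
      (k = 0 → haggLabel s k = 0 → (i, j) = (1, 0) ∨ (i, j) = (-1, 0) ∨ (i, j) = (0, 1) ∨
        (i, j) = (0, -1) ∨ (i, j) = (1, -1) ∨ (i, j) = (-1, 1)) ∧
      (k ≠ 0 → haggLabel s k = 1 → (i, j) = (0, 0) ∨ (i, j) = (-1, 0) ∨ (i, j) = (0, -1)) ∧
      (k ≠ 0 → haggLabel s k = -1 → (i, j) = (0, 0) ∨ (i, j) = (1, 0) ∨ (i, j) = (0, 1)) := by
    intro s k i j hk hne hnorm
    have hsq : ‖barlowPos a₀ h₀ s k i j‖ ^ 2 < (13 / 10 * a₀) ^ 2 :=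
      pow_lt_pow_left₀ hnorm (norm_nonneg _) two_ne_zero
    rw [barlowPos_eq_laPt a₀ h₀ s hk] at hsq hne
    rw [norm_laPt_sq] at hsq
    refine ⟨fun hk0 hL => ?_, fun hk0 hL => ?_, fun hk0 hL => ?_⟩
    · subst hk0
      rw [hL] at hsq hne
      simp only [laHt] at hsq
      norm_num at hsq
      have hQ : (i : ℝ) ^ 2 + i * j + j ^ 2 < 169 / 100 := by nlinarith
      have hQ' : i ^ 2 + i * j + j ^ 2 ≤ 1 := by
        have : ((i ^ 2 + i * j + j ^ 2 : ℤ) : ℝ) < 2 := by push_cast; linarith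
        have : i ^ 2 + i * j + j ^ 2 < 2 := by exact_mod_cast this
        omega
      -- the hexagon census (the landed `PrestressSplitKorn.int_form_le_one`, re-derived to keep the imports light)
      have hne' : (i, j) ≠ (0, 0) := by
        rintro ⟨⟩
        apply hne
        simp [laPt, laHt]
      have hj1 : 3 * j ^ 2 ≤ 4 := by nlinarith [sq_nonneg (2 * i + j)]
      have hi1 : 3 * i ^ 2 ≤ 4 := by nlinarith [sq_nonneg (2 * j + i)]
      have hj2 : -1 ≤ j := by nlinarith
      have hj3 : j ≤ 1 := by nlinarith
      have hi2 : -1 ≤ i := by nlinarith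
      have hi3 : i ≤ 1 := by nlinarith
      interval_cases i <;> interval_cases j <;> simp_all
    · have hHt : laHt h₀ h₀ k ^ 2 = h₀ ^ 2 := by
        rcases hk with rfl | rfl | rfl
        · simp [laHt]
        · exact absurd rfl hk0
        · simp [laHt]
      rw [hL, hHt] at hsq
      norm_num at hsq
      have hQ : (i : ℝ) ^ 2 + i * j + j ^ 2 + i + j < 71 / 100 := by nlinarith
      have hQ' : i ^ 2 + i * j + j ^ 2 + i + j ≤ 0 := by
        have : ((i ^ 2 + i * j + j ^ 2 + i + j : ℤ) : ℝ) < 1 := by push_cast; linarith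
        have : i ^ 2 + i * j + j ^ 2 + i + j < 1 := by exact_mod_cast this
        omega
      exact triangle_of_form_le_zero hQ'
    · have hHt : laHt h₀ h₀ k ^ 2 = h₀ ^ 2 := by
        rcases hk with rfl | rfl | rfl
        · simp [laHt]
        · exact absurd rfl hk0
        · simp [laHt]
      rw [hL, hHt] at hsq
      norm_num at hsq
      have hQ : (i : ℝ) ^ 2 + i * j + j ^ 2 - i - j < 71 / 100 := by nlinarith
      have hQ' : i ^ 2 + i * j + j ^ 2 - i - j ≤ 0 := by
        have : ((i ^ 2 + i * j + j ^ 2 - i - j : ℤ) : ℝ) < 1 := by push_cast; linarith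
        have : i ^ 2 + i * j + j ^ 2 - i - j < 1 := by exact_mod_cast this
        omega
      exact triangle_of_form_le_zero' hQ'
  constructor
  · -- hcp: alternating word, labels `0, 1, 1` on the layers `0, 1, -1`
    ext p
    simp only [Set.mem_setOf_eq, Set.mem_range, hcpStacking, barlowStacking]
    constructor
    · rintro ⟨⟨k, i, j, rfl⟩, hne, hnorm⟩
      have hk := layer_of_norm_lt hlo hh0 alternatingHagg hnorm
      obtain ⟨h0, h1, -⟩ := hcensus alternatingHagg k i j hk hne hnorm
      have hLab : haggLabel alternatingHagg k = (if k = 0 then 0 else 1) := by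
        rcases hk with rfl | rfl | rfl <;> rw [haggLabel_alternating] <;> decide
      rw [barlowPos_eq_laPt a₀ h₀ alternatingHagg hk, hLab]
      rcases hk with rfl | rfl | rfl
      · rcases h1 (by norm_num) (by rw [hLab]; norm_num) with h | h | h <;>
          simp only [Prod.mk.injEq] at h <;> obtain ⟨rfl, rfl⟩ := h
        · exact ⟨9, by rw [slotH_eq_laPt]; exact congrArg _ (by decide)⟩
        · exact ⟨10, by rw [slotH_eq_laPt]; exact congrArg _ (by decide)⟩
        · exact ⟨11, by rw [slotH_eq_laPt]; exact congrArg _ (by decide)⟩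
      · rcases h0 rfl (by simp) with h | h | h | h | h | h <;>
          simp only [Prod.mk.injEq] at h <;> obtain ⟨rfl, rfl⟩ := h
        · exact ⟨0, by rw [slotH_eq_laPt]; exact congrArg _ (by decide)⟩
        · exact ⟨1, by rw [slotH_eq_laPt]; exact congrArg _ (by decide)⟩
        · exact ⟨2, by rw [slotH_eq_laPt]; exact congrArg _ (by decide)⟩
        · exact ⟨3, by rw [slotH_eq_laPt]; exact congrArg _ (by decide)⟩
        · exact ⟨4, by rw [slotH_eq_laPt]; exact congrArg _ (by decide)⟩
        · exact ⟨5, by rw [slotH_eq_laPt]; exact congrArg _ (by decide)⟩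
      · rcases h1 (by norm_num) (by rw [hLab]; norm_num) with h | h | h <;>
          simp only [Prod.mk.injEq] at h <;> obtain ⟨rfl, rfl⟩ := h
        · exact ⟨6, by rw [slotH_eq_laPt]; exact congrArg _ (by decide)⟩
        · exact ⟨7, by rw [slotH_eq_laPt]; exact congrArg _ (by decide)⟩
        · exact ⟨8, by rw [slotH_eq_laPt]; exact congrArg _ (by decide)⟩
    · rintro ⟨m, rfl⟩
      obtain ⟨k, i, j, hk, hcode⟩ := laCodeH_barlow m
      have hLab : haggLabel alternatingHagg k = (if k = 0 then 0 else 1) := by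
        rcases hk with rfl | rfl | rfl <;> rw [haggLabel_alternating] <;> decide
      have hs := hslot false m
      simp only [laSlot, Bool.false_eq_true, ↓reduceIte] at hs
      exact ⟨⟨k, i, j, by rw [barlowPos_eq_laPt _ _ _ hk, slotH_eq_laPt, hcode, hLab]⟩, hs.1, hs.2⟩
  · -- fcc: constant word, label `k` on layer `k`
    ext p
    simp only [Set.mem_setOf_eq, Set.mem_range, fccStacking, barlowStacking]
    constructor
    · rintro ⟨⟨k, i, j, rfl⟩, hne, hnorm⟩
      have hk := layer_of_norm_lt hlo hh0 constHagg hnorm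
      obtain ⟨h0, h1, h2⟩ := hcensus constHagg k i j hk hne hnorm
      rw [barlowPos_eq_laPt a₀ h₀ constHagg hk, haggLabel_const]
      rcases hk with rfl | rfl | rfl
      · rcases h2 (by norm_num) (by rw [haggLabel_const]) with h | h | h <;>
          simp only [Prod.mk.injEq] at h <;> obtain ⟨rfl, rfl⟩ := h
        · exact ⟨9, by rw [slotC_eq_laPt]; exact congrArg _ (by decide)⟩
        · exact ⟨10, by rw [slotC_eq_laPt]; exact congrArg _ (by decide)⟩
        · exact ⟨11, by rw [slotC_eq_laPt]; exact congrArg _ (by decide)⟩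
      · rcases h0 rfl (by simp) with h | h | h | h | h | h <;>
          simp only [Prod.mk.injEq] at h <;> obtain ⟨rfl, rfl⟩ := h
        · exact ⟨0, by rw [slotC_eq_laPt]; exact congrArg _ (by decide)⟩
        · exact ⟨1, by rw [slotC_eq_laPt]; exact congrArg _ (by decide)⟩
        · exact ⟨2, by rw [slotC_eq_laPt]; exact congrArg _ (by decide)⟩
        · exact ⟨3, by rw [slotC_eq_laPt]; exact congrArg _ (by decide)⟩
        · exact ⟨4, by rw [slotC_eq_laPt]; exact congrArg _ (by decide)⟩
        · exact ⟨5, by rw [slotC_eq_laPt]; exact congrArg _ (by decide)⟩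
      · rcases h1 (by norm_num) (by rw [haggLabel_const]) with h | h | h <;>
          simp only [Prod.mk.injEq] at h <;> obtain ⟨rfl, rfl⟩ := h
        · exact ⟨6, by rw [slotC_eq_laPt]; exact congrArg _ (by decide)⟩
        · exact ⟨7, by rw [slotC_eq_laPt]; exact congrArg _ (by decide)⟩
        · exact ⟨8, by rw [slotC_eq_laPt]; exact congrArg _ (by decide)⟩
    · rintro ⟨m, rfl⟩
      obtain ⟨k, i, j, hk, hcode⟩ := laCodeC_barlow m
      have hs := hslot true m
      simp only [laSlot, ↓reduceIte] at hs
      exact ⟨⟨k, i, j, by rw [barlowPos_eq_laPt _ _ _ hk, slotC_eq_laPt, hcode, haggLabel_const]⟩, hs.1, hs.2⟩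

/-- **Radial band of the slots on the box**: every slot of either model has norm in `[0.98a₀, 1.02a₀]`.
[folklore] -/
theorem laSlot_norm_band {a₀ h₀ : ℝ} (ha : 47 / 50 ≤ a₀) (hh : |h₀ - a₀ * Real.sqrt (2 / 3)| ≤ a₀ / 100)
    (t : Bool) (k : Fin 12) :
    a₀ * (1 - 1 / 50) ≤ ‖laSlot t a₀ h₀ h₀ k‖ ∧ ‖laSlot t a₀ h₀ h₀ k‖ ≤ a₀ * (1 + 1 / 50) := by
  obtain ⟨ha0, hlo, hhi⟩ := inBox_bounds ha hh
  have hn := la_norm_code (kp := h₀) (km := h₀) ha0 t k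
  rw [← laSlot_eq_laPt] at hn
  have h0 : 0 ≤ ‖laSlot t a₀ h₀ h₀ k‖ := norm_nonneg _
  rcases hn with ⟨-, hn⟩ | ⟨-, hn⟩ | ⟨-, hn⟩
  · rw [hn]; constructor <;> nlinarith
  · constructor
    · exact (pow_le_pow_iff_left₀ (by nlinarith) h0 two_ne_zero).1 (by rw [hn]; nlinarith)
    · exact (pow_le_pow_iff_left₀ h0 (by nlinarith) two_ne_zero).1 (by rw [hn]; nlinarith)
  · constructor
    · exact (pow_le_pow_iff_left₀ (by nlinarith) h0 two_ne_zero).1 (by rw [hn]; nlinarith)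
    · exact (pow_le_pow_iff_left₀ h0 (by nlinarith) two_ne_zero).1 (by rw [hn]; nlinarith)

end Summit.AtomisticToContinuum.Crystallization.Theorems.ShellsToLayers

end
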